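import Mathlib.Analysis.InnerProductSpace.Spectrum
import Literature.Analysis.Fourier.GaussianMultiplierTest
import Literature.Analysis.Fourier.LpMultiplierIsometry
import HarnessLib

/-!
# `e^{iQ} ∉ M_p` (`p < 2`) for a non-zero quadratic form `Q` on an inner product space

The coordinate-free form of the Gaussian test (`GaussianMultiplierTest.lean`), i.e. of
[BrennerThomeeWahlbin1975, Ch. 1 Cor 5.3] for quadratic forms and `p < 2`, as consumed by
[loc. cit., Ch. 5, proof of Lemma 1.1] ("`exp(iQ) ∈ M_p`, and since `p ≠ 2` this implies by
Corollary 1.5.3 that `Q` vanishes identically"): if `S` is a symmetric operator on the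
finite-dimensional real inner product space `V` and `e^{i⟨ξ, Sξ⟩} • 1` is an `Lᵖ` multiplier
for some `1 ≤ p < 2`, then `S = 0`. Proof: diagonalise `S` in an orthonormal eigenbasis
(`LinearMap.IsSymmetric.eigenvectorBasis`), transport the multiplier to
`EuclideanSpace ℝ (Fin n)` along the coordinate isometry (`IsLpMultiplier.comp_linearIsometryEquiv`),
where the phase becomes `Σ λᵢ ηᵢ²`, and apply `eq_zero_of_isLpMultiplier_exp_I_quadratic`.

## References

* [BrennerThomeeWahlbin1975] P. Brenner, V. Thomée, L. B. Wahlbin, LNM 434 (1975), Ch. 1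
  Cor 5.3; Ch. 5 §1, proof of Lemma 1.1.
-/

noncomputable section

open MeasureTheory FourierTransform Complex
open scoped ENNReal NNReal InnerProductSpace

namespace Literature.Analysis.Fourier

variable {V : Type*} [NormedAddCommGroup V] [InnerProductSpace ℝ V] [FiniteDimensional ℝ V]
  [MeasurableSpace V] [BorelSpace V]

omit [MeasurableSpace V] [BorelSpace V] in
/-- In the coordinates of an orthonormal eigenbasis, `⟨x, Sx⟩ = Σᵢ λᵢ ηᵢ²`. [folklore] -/
theorem inner_self_apply_eq_sum_eigenvalues {S : V →ₗ[ℝ] V} (hS : S.IsSymmetric) {n : ℕ}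
    (hn : Module.finrank ℝ V = n) (η : EuclideanSpace ℝ (Fin n)) :
    inner ℝ ((hS.eigenvectorBasis hn).repr.symm η) (S ((hS.eigenvectorBasis hn).repr.symm η))
      = ∑ i, hS.eigenvalues hn i * (η i) ^ 2 := by
  set b := hS.eigenvectorBasis hn with hb
  set x : V := b.repr.symm η with hx
  have hη : b.repr x = η := by rw [hx, LinearIsometryEquiv.apply_symm_apply]
  rw [← b.repr.inner_map_map, inner_euclideanSpace_eq_sum]
  refine Finset.sum_congr rfl fun i _ => ?_
  rw [hS.eigenvectorBasis_apply_self_apply hn x i, hη]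
  simp only [RCLike.ofReal_real_eq_id, id_eq]
  ring

/-- **`e^{i⟨ξ,Sξ⟩} ∈ M_p`, `1 ≤ p < 2`, forces `S = 0`** (symmetric `S`; the scalar symbol acting
as `e^{i⟨ξ,Sξ⟩} • 1` on `ℂ^κ`-valued functions, `κ` non-empty).
[cite: BrennerThomeeWahlbin1975, Ch. 1 Cor 5.3] -/
theorem eq_zero_of_isLpMultiplier_exp_I_inner_self {κ : Type*} [Fintype κ] [DecidableEq κ]
    (k₀ : κ) {S : V →ₗ[ℝ] V} (hS : S.IsSymmetric) {p : ℝ} (hp1 : 1 ≤ p) (hp2 : p < 2)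
    (h : IsLpMultiplier (ENNReal.ofReal p)
      (fun ξ : V => cexp (I * ((inner ℝ ξ (S ξ) : ℝ) : ℂ)) • (1 : Matrix κ κ ℂ))) :
    S = 0 := by
  set n := Module.finrank ℝ V with hndef
  have hn : Module.finrank ℝ V = n := rfl
  set b := hS.eigenvectorBasis hn with hb
  set lam := hS.eigenvalues hn with hlam
  -- transport to `EuclideanSpace ℝ (Fin n)` along `b.repr.symm`
  have h' := h.comp_linearIsometryEquiv b.repr.symm
  have heq : (fun η : EuclideanSpace ℝ (Fin n) =>
      cexp (I * ((inner ℝ (b.repr.symm η) (S (b.repr.symm η)) : ℝ) : ℂ)) • (1 : Matrix κ κ ℂ))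
      = fun η : EuclideanSpace ℝ (Fin n) =>
        cexp (I * ((∑ i, lam i * (η i) ^ 2 : ℝ) : ℂ)) • (1 : Matrix κ κ ℂ) := by
    funext η
    rw [inner_self_apply_eq_sum_eigenvalues hS hn η]
  rw [heq] at h'
  have hlam0 : ∀ i, lam i = 0 := fun i =>
    eq_zero_of_isLpMultiplier_exp_I_quadratic k₀ lam hp1 hp2 h' i
  -- all eigenvalues vanish, hence `S = 0`
  refine b.toBasis.ext fun i => ?_
  rw [OrthonormalBasis.coe_toBasis, LinearMap.zero_apply, hS.apply_eigenvectorBasis hn i]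
  rw [show hS.eigenvalues hn i = 0 from hlam0 i]
  simp

end Literature.Analysis.Fourier

end
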